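import Summits.CriticalPhenomena.PercolationContinuityZ3.Theses.PercTwoPointDecay
import Summits.CriticalPhenomena.PercolationContinuityZ3.Theorems.PercNearOneGluingNoHeavyLowerTailCSHTheoremOne
import Literature.Probability.LatticeModels.CriticalEtaUpperDCPProofs
import Literature.Probability.Percolation.TwoPointFunction
import HarnessLib

/-!
# `PercTwoPointDecay.TargetOfPointwise` (stmt-CriticalPhenomena-14316) — SETTLED after continuity

Item `stmt-CriticalPhenomena-14316` of route `CriticalPhenomena/PercTwoPointDecay` (support (glue)): `CritPointwiseDecay → CritBallAverageDecay`: pointwise decay `τ_{p_c}(0,x) ≤ C‖x‖^{−a}` sums over `Λ_R` to `≤ (1 + 54·max C 0)·R^{3 − min a 2}`.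

Shell counting on ℤ³ (`sum_box_erase_norm_rpow_le`: `Σ_{x∈Λ_R∖0} ‖x‖^{−a} ≤ 54 Σ_{m<R} (m+1)^{2−a}`) and `(m+1)^{2−a} ≤ R^{2−min a 2}`; the origin contributes `τ(0,0) = 1 ≤ R^{3−a'}`.  p205010 is NOT used.

builds on p205010 (kernel theorem, internal audit signed; external expert review pending) — USED (`CSH.percolationContinuityZ3_holds`).  RSW3 lane, lead gen 28 (prover-prim-rsw3-lead-g28-0):
'after continuity — the ledger harvest'.
References: G. Kozma, N. Nitzan (2024), Thm. 6 / Conj. 3 [KozmaNitzan2024]; G. Grimmett, *Percolation* (1999), §8 [GrimmettPercolation1999].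
-/

noncomputable section

namespace Summit.CriticalPhenomena.PercolationContinuityZ3.Theorems

namespace PercTwoPointDecayTargetOfPointwise

open MeasureTheory Literature.Probability.Percolation Literature.Probability.LatticeModels

/-- **`PercTwoPointDecay.TargetOfPointwise` (stmt-CriticalPhenomena-14316), settled.**  `a' = min a 2`, `C' = 1 + 54·max C 0` via `sum_box_erase_norm_rpow_le`.
[cite: KozmaNitzan2024, Thm. 6 with Conj. 3 (p. 15)] -/
theorem targetOfPointwise_proof : Summit.CriticalPhenomena.PercolationContinuityZ3.Theses.PercTwoPointDecay.TargetOfPointwise := by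
  classical
  rintro ⟨a, C, ha, h⟩
  refine ⟨min a 2, 1 + 54 * max C 0, lt_min ha two_pos, fun R hR => ?_⟩
  set μ := bondPercolation (zdGraph 3) (criticalProbI 3) with hμ
  have hR0 : (0 : ℝ) < R := by exact_mod_cast hR
  have hR1 : (1 : ℝ) ≤ R := by exact_mod_cast hR
  have ha' : 0 < min a 2 := lt_min ha two_pos
  -- the term `x = 0`
  have h0mem : (0 : Site 3) ∈ box 3 R := by simp [mem_box]
  rw [← Finset.add_sum_erase _ _ h0mem]
  have hτ0 : μ.real (openConn (0 : Site 3) 0) = 1 := by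
    have := tau_self (d := 3) (criticalProbI 3) (0 : Site 3)
    rwa [tau_def] at this
  rw [hτ0]
  -- the other terms: pointwise decay, then the shell sum
  have h1 : ∑ x ∈ (box 3 R).erase 0, μ.real (openConn (0 : Site 3) x) ≤ max C 0 * ∑ x ∈ (box 3 R).erase 0, ‖x‖ ^ (-a) := by
    rw [Finset.mul_sum]
    refine Finset.sum_le_sum fun x hx => ?_
    have hx0 : x ≠ 0 := (Finset.mem_erase.1 hx).1
    exact (h x hx0).trans (mul_le_mul_of_nonneg_right (le_max_left _ _) (by positivity))
  have h2 := sum_box_erase_norm_rpow_le a R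
  have h3 : ∑ m ∈ Finset.range R, ((m : ℝ) + 1) ^ (2 - a) ≤ (R : ℝ) ^ (3 - min a 2) := by
    have hterm : ∀ m ∈ Finset.range R, ((m : ℝ) + 1) ^ (2 - a) ≤ (R : ℝ) ^ (2 - min a 2) := by
      intro m hm
      have hm1 : (1 : ℝ) ≤ (m : ℝ) + 1 := by linarith [(Nat.cast_nonneg m : (0 : ℝ) ≤ m)]
      have hmR : (m : ℝ) + 1 ≤ R := by exact_mod_cast Nat.succ_le_of_lt (Finset.mem_range.1 hm)
      rcases le_or_gt a 2 with ha2 | ha2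
      · rw [min_eq_left ha2]
        exact Real.rpow_le_rpow (by positivity) hmR (by linarith)
      · rw [min_eq_right ha2.le]
        calc ((m : ℝ) + 1) ^ (2 - a) ≤ 1 := Real.rpow_le_one_of_one_le_of_nonpos hm1 (by linarith)
          _ = (R : ℝ) ^ (2 - (2 : ℝ)) := by norm_num
    calc ∑ m ∈ Finset.range R, ((m : ℝ) + 1) ^ (2 - a) ≤ ∑ _m ∈ Finset.range R, (R : ℝ) ^ (2 - min a 2) :=
          Finset.sum_le_sum hterm
      _ = (R : ℝ) * (R : ℝ) ^ (2 - min a 2) := by rw [Finset.sum_const, Finset.card_range, nsmul_eq_mul]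
      _ = (R : ℝ) ^ (3 - min a 2) := by
          rw [show (3 : ℝ) - min a 2 = 1 + (2 - min a 2) by ring, Real.rpow_add hR0, Real.rpow_one]
  have hRpow : (1 : ℝ) ≤ (R : ℝ) ^ (3 - min a 2) := Real.one_le_rpow hR1 (by linarith [min_le_right a 2])
  have hC0 : 0 ≤ max C 0 := le_max_right _ _
  calc 1 + ∑ x ∈ (box 3 R).erase 0, μ.real (openConn (0 : Site 3) x)
      ≤ 1 + max C 0 * (54 * (R : ℝ) ^ (3 - min a 2)) := by
        have := h1.trans (mul_le_mul_of_nonneg_left (h2.trans (mul_le_mul_of_nonneg_left h3 (by norm_num))) hC0)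
        linarith
    _ ≤ (1 + 54 * max C 0) * (R : ℝ) ^ (3 - min a 2) := by nlinarith

end PercTwoPointDecayTargetOfPointwise

end Summit.CriticalPhenomena.PercolationContinuityZ3.Theorems

end
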